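import Mathlib
import HarnessLib
import Summits.NavierStokesRegularity.NavierStokesRegularity.Theorems.TypeILiouvilleLambTailFading

/-!
# TypeILiouvilleLambTailSlaving — crux (L) stmt-NavierStokesRegularity-10661 `TypeIliouvilleL`:
# IN PRINT'S CLASS THE VORTICITY IS SLAVED TO THE VORTEX COMMUTATOR (part 4 of `TypeILiouvilleLambTail`)

Helper for stmt-NavierStokesRegularity-10661 (`--supports`); theorems only, no definitions, no named-fact
hypotheses; closes no item; Navier–Stokes regularity is NOT proved here (leafhand seat of the EulerZoomLiouville route).

Class P (`‖v‖ ≤ K` on `(−∞,0) × ℝ³`), `ω = curl v`, vortex commutator `f = Dv[ω] − Dω[v] = curl(v × ω)` as in parts 1–3.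
The Lamb-tail budget of part 2 with a CONSTANT majorant on a window of length `λ` reads
`‖ω(t,x)‖ ≤ c K λ^{−1/2} + B λ` (`c = ‖curl‖ 2^{3/2}`, `‖f‖ ≤ B` on `[t−λ,t]`); optimising `λ`:

* `norm_curl_le_of_commutator_bound_window` — the window form above, every `λ > 0`.
* `norm_curl_le_rpow_of_commutator_bound` — ★ **THE SLAVING INEQUALITY**: if `‖f(τ,x)‖ ≤ B` for all `τ < 0`, `x`,
  then `‖ω(t,x)‖ ≤ (c + 1) K^{2/3} B^{1/3}` on `(−∞,0) × ℝ³`.  Scaling-covariant under `v ↦ λv(λ²t,λx)`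
  (`K ↦ λK`, `B ↦ λ⁴B`, `ω ↦ λ²ω`); `B = 0` is the generalized-Beltrami theorem (irrotational, hence constant); small
  `B` = NEAR-BELTRAMI ancient flows have uniformly SMALL vorticity.  An a-priori inequality special to ANCIENT bounded
  flows (it integrates the forced heat equation for `ω` over an arbitrarily long past).
* `curl_fading_of_commutator_fading` / `quiescent_of_commutator_fading` — ★ **ASYMPTOTICALLY BELTRAMI ⟹ FADING VORTICITY
  ⟹ QUIESCENT**: if `sup_x ‖curl(v × ω)(τ,x)‖ → 0` as `τ → −∞` (no integrability asked), the vorticity fades and the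
  flow is quiescent (tree `quiescent_of_curl_fading`); `const_of_commutator_fading_of_quiescentLiouville` records BY NAME
  that the registered stub L_Q (`stub_quiescentLiouville`) decides this stratum too.

READING for the residual of (L): a non-constant member of print's class outside L_Q keeps its vortex commutator
`curl(v × ω)` BOUNDED AWAY FROM ZERO in sup norm along a sequence of times `τ_k → −∞`.
HONEST LABEL: classical estimates on print's class; nothing here proves a registered stub, (L), or Navier–Stokes
regularity; rung 0.
[cite: KochNadirashviliSereginSverak2009, §4 (i), Lemma 6.1 (arXiv:0709.3599)] [cite: GigaGigaSaal2010, §1.1.3]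
[cite: MajdaBertozziCUP2002, eq. (2.110), §2.3]
-/

noncomputable section
open MeasureTheory Filter Set Function Metric
open scoped Topology ENNReal RealInnerProductSpace Laplacian ContDiff
open Literature.Analysis Literature.Analysis.FluidPDE Literature.Analysis.UnboundedOperators
set_option linter.dupNamespace false
namespace Summit.NavierStokesRegularity.NavierStokesRegularity.Theorems.TypeILiouvilleLambTail

/-- **WINDOW FORM**: for a class-P flow with `‖v‖ ≤ K`, `t < 0`, `λ > 0` and a constant bound `‖Dv[ω] − Dω[v]‖ ≤ B` on
the window `[t−λ, t] × ℝ³`: `‖ω(t,x)‖ ≤ ‖curl‖ 2^{3/2} K λ^{−1/2} + B λ` (part 2 budget with `s = t − λ`, `φ ≡ B`).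
[cite: KochNadirashviliSereginSverak2009, §4 (i) (arXiv:0709.3599)] [cite: GigaGigaSaal2010, §1.1.3] -/
theorem norm_curl_le_of_commutator_bound_window
    {v : ℝ → EuclideanSpace ℝ (Fin 3) → EuclideanSpace ℝ (Fin 3)}
    (hc : ContinuousOn (uncurry v) (Iio 0 ×ˢ univ))
    {K : ℝ} (hKb : ∀ t < 0, ∀ x, ‖v t x‖ ≤ K)
    (hd : ∀ t < 0, IsWeaklyDivFree (v t))
    (hm : ∀ s t : ℝ, s < t → t < 0 → ∀ x,
      v t x = heatExtension (v s) (t - s) x - oseenDuhamel 1 s v v t x)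
    {t : ℝ} (ht : t < 0) {lam : ℝ} (hlam : 0 < lam) {B : ℝ}
    (hB : ∀ τ ∈ Icc (t - lam) t, ∀ x : EuclideanSpace ℝ (Fin 3),
      ‖fderiv ℝ (v τ) x (curl (v τ) x) - fderiv ℝ (curl (v τ)) x (v τ x)‖ ≤ B)
    (x : EuclideanSpace ℝ (Fin 3)) :
    ‖curl (v t) x‖ ≤
      ‖curlCLM‖ * ((2 : ℝ) ^ ((Module.finrank ℝ (EuclideanSpace ℝ (Fin 3)) : ℝ) / 2) * lam ^ (-(1 / 2 : ℝ)) * K) +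
        B * lam := by
  have hst : t - lam < t := by linarith
  have h := norm_curl_le_of_commutator_majorant hc hKb hd hm hst ht (φ := fun _ => B) continuous_const hB x
  rw [intervalIntegral.integral_const, smul_eq_mul, show t - (t - lam) = lam by ring] at h
  linarith [mul_comm lam B]

/-- ★ **THE SLAVING INEQUALITY: in print's class the vorticity is slaved to the vortex commutator.**  If `‖v‖ ≤ K` and
`‖Dv[ω] − Dω[v]‖ = ‖curl(v × ω)‖ ≤ B` on `(−∞,0) × ℝ³`, then
`‖ω(t,x)‖ ≤ (‖curl‖ 2^{3/2} + 1) · K^{2/3} · B^{1/3}` for all `t < 0`, `x`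
(window `λ = (K/B)^{2/3}` when `K, B > 0`; `B = 0` or `K = 0` give `ω ≡ 0` by `λ → ∞`).  Scaling-covariant;
near-Beltrami ancient bounded flows have uniformly small vorticity.
[cite: KochNadirashviliSereginSverak2009, §4 (i) (arXiv:0709.3599)] [cite: GigaGigaSaal2010, §1.1.3] -/
theorem norm_curl_le_rpow_of_commutator_bound
    {v : ℝ → EuclideanSpace ℝ (Fin 3) → EuclideanSpace ℝ (Fin 3)}
    (hc : ContinuousOn (uncurry v) (Iio 0 ×ˢ univ))
    {K : ℝ} (hKb : ∀ t < 0, ∀ x, ‖v t x‖ ≤ K)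
    (hd : ∀ t < 0, IsWeaklyDivFree (v t))
    (hm : ∀ s t : ℝ, s < t → t < 0 → ∀ x,
      v t x = heatExtension (v s) (t - s) x - oseenDuhamel 1 s v v t x)
    {B : ℝ} (hB : ∀ τ < 0, ∀ x : EuclideanSpace ℝ (Fin 3),
      ‖fderiv ℝ (v τ) x (curl (v τ) x) - fderiv ℝ (curl (v τ)) x (v τ x)‖ ≤ B)
    {t : ℝ} (ht : t < 0) (x : EuclideanSpace ℝ (Fin 3)) :
    ‖curl (v t) x‖ ≤
      (‖curlCLM‖ * (2 : ℝ) ^ ((Module.finrank ℝ (EuclideanSpace ℝ (Fin 3)) : ℝ) / 2) + 1) *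
        K ^ (2 / 3 : ℝ) * B ^ (1 / 3 : ℝ) := by
  set c : ℝ := ‖curlCLM‖ * (2 : ℝ) ^ ((Module.finrank ℝ (EuclideanSpace ℝ (Fin 3)) : ℝ) / 2) with hc_def
  have hc0 : 0 ≤ c := mul_nonneg (norm_nonneg curlCLM) (by positivity)
  have hK0 : 0 ≤ K := (norm_nonneg _).trans (hKb (-1) (by norm_num) 0)
  have hB0 : 0 ≤ B := (norm_nonneg _).trans (hB (-1) (by norm_num) 0)
  -- the window form for every `λ > 0`
  have hwin : ∀ lam : ℝ, 0 < lam → ‖curl (v t) x‖ ≤ c * K * lam ^ (-(1 / 2 : ℝ)) + B * lam := by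
    intro lam hlam
    have h := norm_curl_le_of_commutator_bound_window hc hKb hd hm ht hlam
      (fun τ hτ y => hB τ (lt_of_le_of_lt hτ.2 ht) y) x
    have heq : ‖curlCLM‖ * ((2 : ℝ) ^ ((Module.finrank ℝ (EuclideanSpace ℝ (Fin 3)) : ℝ) / 2) *
        lam ^ (-(1 / 2 : ℝ)) * K) = c * K * lam ^ (-(1 / 2 : ℝ)) := by rw [hc_def]; ring
    linarith
  have hrhs : 0 ≤ (c + 1) * K ^ (2 / 3 : ℝ) * B ^ (1 / 3 : ℝ) := by positivity
  by_cases hBz : B = 0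
  · -- `B = 0`: `‖ω‖ ≤ c K λ^{-1/2} → 0` as `λ → ∞`
    have hlim : Tendsto (fun lam : ℝ => c * K * lam ^ (-(1 / 2 : ℝ)) + B * lam) atTop (𝓝 0) := by
      subst hBz
      have h1 : Tendsto (fun lam : ℝ => lam ^ (-(1 / 2 : ℝ))) atTop (𝓝 0) :=
        tendsto_rpow_neg_atTop (by norm_num : (0 : ℝ) < 1 / 2)
      have h2 := h1.const_mul (c * K)
      rw [mul_zero] at h2
      exact h2.congr fun lam => by ring
    have hzero : ‖curl (v t) x‖ ≤ 0 :=
      ge_of_tendsto hlim ((eventually_gt_atTop 0).mono fun lam hlam => hwin lam hlam)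
    linarith
  have hBpos : 0 < B := lt_of_le_of_ne hB0 (Ne.symm hBz)
  by_cases hKz : K = 0
  · -- `K = 0`: `‖ω‖ ≤ B λ` for every `λ > 0`
    have hzero : ‖curl (v t) x‖ ≤ 0 := by
      refine le_of_forall_pos_le_add fun ε hε => ?_
      have h := hwin (ε / B) (div_pos hε hBpos)
      rw [hKz, mul_zero, zero_mul, zero_add, mul_div_cancel₀ ε hBpos.ne'] at h
      linarith
    linarith
  · have hKpos : 0 < K := lt_of_le_of_ne hK0 (Ne.symm hKz)
    -- the optimal window `λ = (K/B)^{2/3}`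
    set lam : ℝ := (K / B) ^ (2 / 3 : ℝ) with hlam_def
    have hKB0 : 0 < K / B := div_pos hKpos hBpos
    have hlam : 0 < lam := Real.rpow_pos_of_pos hKB0 _
    have h := hwin lam hlam
    -- evaluate the two terms
    have h1 : lam ^ (-(1 / 2 : ℝ)) = (K / B) ^ (-(1 / 3 : ℝ)) := by
      rw [hlam_def, ← Real.rpow_mul hKB0.le]; norm_num
    have h2 : K * (K / B) ^ (-(1 / 3 : ℝ)) = K ^ (2 / 3 : ℝ) * B ^ (1 / 3 : ℝ) := by
      have e1 : (K / B) ^ (-(1 / 3 : ℝ)) = B ^ (1 / 3 : ℝ) / K ^ (1 / 3 : ℝ) := by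
        rw [Real.rpow_neg hKB0.le, Real.div_rpow hKpos.le hBpos.le, inv_div]
      calc K * (K / B) ^ (-(1 / 3 : ℝ)) = K * (B ^ (1 / 3 : ℝ) / K ^ (1 / 3 : ℝ)) := by rw [e1]
        _ = (K ^ (1 : ℝ) / K ^ (1 / 3 : ℝ)) * B ^ (1 / 3 : ℝ) := by rw [Real.rpow_one]; ring
        _ = K ^ ((1 : ℝ) - 1 / 3) * B ^ (1 / 3 : ℝ) := by rw [Real.rpow_sub hKpos]
        _ = K ^ (2 / 3 : ℝ) * B ^ (1 / 3 : ℝ) := by norm_num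
    have h3 : B * lam = K ^ (2 / 3 : ℝ) * B ^ (1 / 3 : ℝ) := by
      calc B * lam = B * (K ^ (2 / 3 : ℝ) / B ^ (2 / 3 : ℝ)) := by rw [hlam_def, Real.div_rpow hKpos.le hBpos.le]
        _ = K ^ (2 / 3 : ℝ) * (B ^ (1 : ℝ) / B ^ (2 / 3 : ℝ)) := by rw [Real.rpow_one]; ring
        _ = K ^ (2 / 3 : ℝ) * B ^ ((1 : ℝ) - 2 / 3) := by rw [Real.rpow_sub hBpos]
        _ = K ^ (2 / 3 : ℝ) * B ^ (1 / 3 : ℝ) := by norm_num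
    calc ‖curl (v t) x‖ ≤ c * K * lam ^ (-(1 / 2 : ℝ)) + B * lam := h
      _ = c * (K ^ (2 / 3 : ℝ) * B ^ (1 / 3 : ℝ)) + K ^ (2 / 3 : ℝ) * B ^ (1 / 3 : ℝ) := by
          rw [h1, mul_assoc, h2, h3]
      _ = (c + 1) * K ^ (2 / 3 : ℝ) * B ^ (1 / 3 : ℝ) := by ring


/-- ★ **ASYMPTOTICALLY BELTRAMI ⟹ FADING VORTICITY.**  If the vortex commutator of a class-P flow tends to zero
uniformly as `τ → −∞` (`sup_x ‖Dv[ω] − Dω[v]‖(τ,x) → 0`; no integrability asked), then `sup_x ‖ω(τ,x)‖ → 0`: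
window form with `λ` large (free part `< η/2`) and then `T` so early that `B λ ≤ η/2` on `[t−λ,t]`, `t < T`.
[cite: KochNadirashviliSereginSverak2009, §4 (i), Lemma 6.1 (arXiv:0709.3599)] -/
theorem curl_fading_of_commutator_fading
    {v : ℝ → EuclideanSpace ℝ (Fin 3) → EuclideanSpace ℝ (Fin 3)}
    (hc : ContinuousOn (uncurry v) (Iio 0 ×ˢ univ))
    (hK : ∃ K : ℝ, ∀ t < 0, ∀ x, ‖v t x‖ ≤ K)
    (hd : ∀ t < 0, IsWeaklyDivFree (v t))
    (hm : ∀ s t : ℝ, s < t → t < 0 → ∀ x,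
      v t x = heatExtension (v s) (t - s) x - oseenDuhamel 1 s v v t x)
    (hf : ∀ η : ℝ, 0 < η → ∃ T : ℝ, T < 0 ∧ ∀ τ < T, ∀ x : EuclideanSpace ℝ (Fin 3),
      ‖fderiv ℝ (v τ) x (curl (v τ) x) - fderiv ℝ (curl (v τ)) x (v τ x)‖ ≤ η) :
    ∀ η : ℝ, 0 < η → ∃ T : ℝ, T < 0 ∧ ∀ τ < T, ∀ x, ‖curl (v τ) x‖ ≤ η := by
  intro η hη
  obtain ⟨K, hKb⟩ := hK
  set c : ℝ := ‖curlCLM‖ * (2 : ℝ) ^ ((Module.finrank ℝ (EuclideanSpace ℝ (Fin 3)) : ℝ) / 2) with hc_def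
  -- a long window makes the free part small
  have hlim : Tendsto (fun lam : ℝ => c * K * lam ^ (-(1 / 2 : ℝ))) atTop (𝓝 0) := by
    have h1 : Tendsto (fun lam : ℝ => lam ^ (-(1 / 2 : ℝ))) atTop (𝓝 0) :=
      tendsto_rpow_neg_atTop (by norm_num : (0 : ℝ) < 1 / 2)
    have h2 := h1.const_mul (c * K)
    rwa [mul_zero] at h2
  obtain ⟨lam₀, hlam₀⟩ := (hlim.eventually (gt_mem_nhds (half_pos hη))).exists_forall_of_atTop
  set lam : ℝ := max lam₀ 1 with hlam_def
  have hlam : 0 < lam := lt_of_lt_of_le one_pos (le_max_right _ _)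
  have hsmall : c * K * lam ^ (-(1 / 2 : ℝ)) < η / 2 := hlam₀ lam (le_max_left _ _)
  -- an early time makes the forced part small
  obtain ⟨T, hT0, hT⟩ := hf (η / (2 * lam)) (by positivity)
  refine ⟨T, hT0, fun t ht x => ?_⟩
  have ht0 : t < 0 := ht.trans hT0
  have h := norm_curl_le_of_commutator_bound_window hc hKb hd hm ht0 hlam (B := η / (2 * lam))
    (fun τ hτ y => hT τ (lt_of_le_of_lt hτ.2 ht) y) x
  have heq : ‖curlCLM‖ * ((2 : ℝ) ^ ((Module.finrank ℝ (EuclideanSpace ℝ (Fin 3)) : ℝ) / 2) *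
      lam ^ (-(1 / 2 : ℝ)) * K) = c * K * lam ^ (-(1 / 2 : ℝ)) := by rw [hc_def]; ring
  have hBl : η / (2 * lam) * lam = η / 2 := by field_simp
  rw [heq, hBl] at h
  linarith

/-- The same with the hypothesis on the CURL OF THE LAMB VECTOR: `sup_x ‖curl(v × ω)(τ,x)‖ → 0` as `τ → −∞` ⟹ fading
vorticity (`curl(v × ω) = Dv[ω] − Dω[v]` on the smooth divergence-free slices of class P).
[cite: MajdaBertozziCUP2002, §1.1, §2.3] -/
theorem curl_fading_of_lambCurl_fading
    {v : ℝ → EuclideanSpace ℝ (Fin 3) → EuclideanSpace ℝ (Fin 3)}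
    (hc : ContinuousOn (uncurry v) (Iio 0 ×ˢ univ))
    (hK : ∃ K : ℝ, ∀ t < 0, ∀ x, ‖v t x‖ ≤ K)
    (hd : ∀ t < 0, IsWeaklyDivFree (v t))
    (hm : ∀ s t : ℝ, s < t → t < 0 → ∀ x,
      v t x = heatExtension (v s) (t - s) x - oseenDuhamel 1 s v v t x)
    (hlamb : ∀ η : ℝ, 0 < η → ∃ T : ℝ, T < 0 ∧ ∀ τ < T, ∀ x : EuclideanSpace ℝ (Fin 3),
      ‖curl (fun y => cross (v τ y) (curl (v τ) y)) x‖ ≤ η) :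
    ∀ η : ℝ, 0 < η → ∃ T : ℝ, T < 0 ∧ ∀ τ < T, ∀ x, ‖curl (v τ) x‖ ≤ η := by
  obtain ⟨K, hKb⟩ := hK
  obtain ⟨hsm', -⟩ := smooth_and_bounds_of_bounded_ancient_oseenMild hc hd hm hKb
  have hsm : IsSmoothSpaceTimeOn (Iio 0) v := hsm'
  have hslice : ∀ τ < 0, ContDiff ℝ 2 (v τ) := fun τ hτ =>
    (hsm.contDiff_slice (mem_Iio.2 hτ)).of_le (by norm_cast)
  have hdiv' : ∀ τ < 0, VectorCalculus.IsDivFree (v τ) := fun τ hτ =>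
    (hd τ hτ).isDivFree_of_contDiff ((hslice τ hτ).of_le (by norm_num))
  refine curl_fading_of_commutator_fading hc ⟨K, hKb⟩ hd hm fun η hη => ?_
  obtain ⟨T, hT0, hT⟩ := hlamb η hη
  refine ⟨T, hT0, fun τ hτ x => ?_⟩
  rw [← TypeILiouvilleGeneralizedBeltrami.curl_lamb_eq_sub (hslice τ (hτ.trans hT0)) (hdiv' τ (hτ.trans hT0)) x]
  exact hT τ hτ x

/-- ★ **ASYMPTOTICALLY BELTRAMI ⟹ QUIESCENT.**  A class-P flow whose vortex commutator tends to zero uniformly as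
`τ → −∞` is quiescent (fading vorticity, then the tree's vorticity dial `quiescent_of_curl_fading`, KNSS Lemma 6.1):
the asymptotically-Beltrami stratum of print's class lies inside the registered residual L_Q.
[cite: KochNadirashviliSereginSverak2009, Lemma 6.1 (arXiv:0709.3599)] -/
theorem quiescent_of_commutator_fading
    {v : ℝ → EuclideanSpace ℝ (Fin 3) → EuclideanSpace ℝ (Fin 3)}
    (hc : ContinuousOn (uncurry v) (Iio 0 ×ˢ univ))
    (hK : ∃ K : ℝ, ∀ t < 0, ∀ x, ‖v t x‖ ≤ K)
    (hd : ∀ t < 0, IsWeaklyDivFree (v t))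
    (hm : ∀ s t : ℝ, s < t → t < 0 → ∀ x,
      v t x = heatExtension (v s) (t - s) x - oseenDuhamel 1 s v v t x)
    (hf : ∀ η : ℝ, 0 < η → ∃ T : ℝ, T < 0 ∧ ∀ τ < T, ∀ x : EuclideanSpace ℝ (Fin 3),
      ‖fderiv ℝ (v τ) x (curl (v τ) x) - fderiv ℝ (curl (v τ)) x (v τ x)‖ ≤ η) :
    ∀ ε : ℝ, 0 < ε → ∃ T : ℝ, T < 0 ∧ ∀ t < T, ∀ x y : EuclideanSpace ℝ (Fin 3),
      dist x y ≤ 1 → ‖v t x - v t y‖ ≤ ε :=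
  TypeILiouvilleStrainLedger.quiescent_of_curl_fading hc hK hd hm (curl_fading_of_commutator_fading hc hK hd hm hf)

/-- **BY NAME on the registered stub `stub_quiescentLiouville` (L_Q)**: L_Q decides the asymptotically-Beltrami stratum —
if every quiescent member of print's class is constant, then every class-P flow with `sup_x‖curl(v × ω)(τ,·)‖ → 0`
(`τ → −∞`, commutator form) is ONE CONSTANT VECTOR.  (Hypothesis = the stub's statement verbatim.)
[cite: KochNadirashviliSereginSverak2009, §4 (i), Lemma 6.1 (arXiv:0709.3599)] -/
theorem const_of_commutator_fading_of_quiescentLiouville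
    (hQ : ∀ v : ℝ → EuclideanSpace ℝ (Fin 3) → EuclideanSpace ℝ (Fin 3),
      ContinuousOn (Function.uncurry v) (Set.Iio 0 ×ˢ Set.univ) →
      (∃ K : ℝ, ∀ t < 0, ∀ x, ‖v t x‖ ≤ K) →
      (∀ t < 0, Literature.Analysis.FluidPDE.IsWeaklyDivFree (v t)) →
      (∀ s t : ℝ, s < t → t < 0 → ∀ x,
        v t x = Literature.Analysis.UnboundedOperators.heatExtension (v s) (t - s) x -
          Literature.Analysis.FluidPDE.oseenDuhamel 1 s v v t x) →
      (∀ ε : ℝ, 0 < ε → ∃ T : ℝ, T < 0 ∧ ∀ t < T, ∀ x y : EuclideanSpace ℝ (Fin 3),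
        dist x y ≤ 1 → ‖v t x - v t y‖ ≤ ε) →
      ∃ b : EuclideanSpace ℝ (Fin 3), ∀ t < 0, ∀ x, v t x = b)
    {v : ℝ → EuclideanSpace ℝ (Fin 3) → EuclideanSpace ℝ (Fin 3)}
    (hc : ContinuousOn (uncurry v) (Iio 0 ×ˢ univ))
    (hK : ∃ K : ℝ, ∀ t < 0, ∀ x, ‖v t x‖ ≤ K)
    (hd : ∀ t < 0, IsWeaklyDivFree (v t))
    (hm : ∀ s t : ℝ, s < t → t < 0 → ∀ x,
      v t x = heatExtension (v s) (t - s) x - oseenDuhamel 1 s v v t x)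
    (hf : ∀ η : ℝ, 0 < η → ∃ T : ℝ, T < 0 ∧ ∀ τ < T, ∀ x : EuclideanSpace ℝ (Fin 3),
      ‖fderiv ℝ (v τ) x (curl (v τ) x) - fderiv ℝ (curl (v τ)) x (v τ x)‖ ≤ η) :
    ∃ b : EuclideanSpace ℝ (Fin 3), ∀ t < 0, ∀ x, v t x = b :=
  hQ v hc hK hd hm (quiescent_of_commutator_fading hc hK hd hm hf)

end Summit.NavierStokesRegularity.NavierStokesRegularity.Theorems.TypeILiouvilleLambTail

end
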